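import Summits.ResolutionOfSingularities.ResolutionOfSingularities.Theorems.FrobeniusLadderFInjectiveMacaulayficationFHalfRowOfWeaklyNondegenerate
import Summits.ResolutionOfSingularities.ResolutionOfSingularities.Theorems.FrobeniusLadderFInjectiveMacaulayficationPointFloorLegalOfIsolated
import Summits.ResolutionOfSingularities.ResolutionOfSingularities.Theorems.FrobeniusLadderFInjectiveMacaulayficationPointFloorNotFullOfFedder
import Summits.ResolutionOfSingularities.ResolutionOfSingularities.Theorems.FrobeniusLadderFInjectiveMacaulayficationPolyAutRowTransport
import Summits.ResolutionOfSingularities.ResolutionOfSingularities.Theorems.FrobeniusLadderFInjectiveMacaulayficationFermatCubicConeGerm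
import HarnessLib

/-!
# THE F-HALFʼS CLASS LEVEL AS ONE KERNEL STATEMENT WITH ONE NAMED OPEN HYPOTHESIS `F108Consumable` («toric resolution of the Newton fan of a convenient polynomial, in the
# consumerʼs fan-table currency»): `F108Consumable k n →` (prime ∧ convenient ∧ weakly non-degenerate ∧ `x̄ᵢ ≠ 0` ∧ regular off the vertex) `→` the point floor is CURED;
# with the elementary per-bed chart/Fedder data also LEGAL ∧ NOT FULL — the whole census row; and the same along coordinate changes fixing the origin
# (crux `FInjectiveMacaulayfication` stmt-ResolutionOfSingularities-15315, chain w45a; res-L1-w45a-plan-1 RULING R22.9 «GO alt-2′ (hypothesis form): land `F108Consumable` as a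
# DEFINITION in the Theorems tree (OURS interface, not Literature) + the one-name CONDITIONAL CLASS THEOREM … (+ the `exists_translate` corollary via ✓p678625)»; seat
# res-L1-w45a-stub-1 g13; scoping memo `L/res-L1-w45a-stub-1/g13-F108-SCOPING.md`)

[OURS · L1 W4.5a] Support file (`--supports stmt-ResolutionOfSingularities-15315 --as helper`). ONE DEFINITION (`@[conjecture] def F108Consumable`, an OURS INTERFACE predicate tagged as an open
obligation node — NOT a Literature fact, NOT an admitted print, NOT proved in the kernel; provable BY NAME later by a toric-infrastructure seat) and theorems that are CONDITIONAL on it as an explicit hypothesis `(hF : F108Consumable k n)`; no axiom, no sorry.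
Nothing of the crux is proved; no census row is proved here (rows of record discharge the data per bed: ✓p660468, the BED W class twin, B9, the σ₅ pilot). AI-written (AI review
is weaker than expert review).

HONESTY NOTE ON `F108Consumable`. It packages, for every CONVENIENT `f ∈ k[X₀..X_{n−1}]` (every variable occurs as a pure power), the DATA BLOCK that ✓ p656605
`FHalfRowOfNewtonNondegenerate.fHalfRow_of_weaklyNondegenerate` consumes: exponent sets `A`, `K` with `(x^A) = 𝔪·(x^K)` (`hIA`, stated in `k[X]`), `K` and `A` `𝔪`-primary
(`hKprim`, `hprim`, `hAJ`), `t` unimodular charts `V c` (`hV`) with vertices `m c ∈ A` (`hm`) and dual-basis neighbours `a c i ∈ A` (`haA`, `hgen`), vertex minimality `hge`, the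
Rees cover certificate `hcov`, and the NEWTON REFINEMENT certificate `hθ`/`hg0` (on every chart the total transform of `f` is a monomial times a polynomial with non-zero constant
term). WE BELIEVE IT TRUE for every field `k` and every `n` — take a unimodular projective refinement `Σ` of `Σ_f ∧ Σ(𝔪)` (for convenient `f` neither fan subdivides the boundary of
the orthant, and star subdivisions at fundamental-parallelepiped points keep it so), `K :=` the lattice points of the polyhedron of a strictly convex integral support function of
`Σ` (vertices, edge neighbours, pure powers), `A := 𝔪·K`; `hcov` follows from `A ⊆ conv(vertices) + ℝⁿ₊` with rational barycentric coefficients — [cite: CoxLittleSchenck2011,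
Thm. 11.1.9 and §11.4] [cite: IshiiSingularities2018, Thm. 4.4.23] are the print facts behind it — BUT IT IS NOT PROVED IN THE KERNEL (scoped at ≈ 6.5–8.5 sessions, R22.9
NO-GO in this chain) and no print states these tables verbatim; every theorem below carries it as a hypothesis and the gate records them as conditional. Per bed the
hypothesis is DISCHARGED BY DATA (kernel-decided fan/K/cover tables: ✓ p660468 BED W, the class twin, B9, the σ₅ pilot), which is how the census rows of record are unconditional.

* §1 `F108Consumable k n : Prop` (definition) and `span_quotient_eq_mul` (the product identity `hIA` read in any quotient `k[X]/F`).
* §2 `affineBlowup_fullCl_of_F108Consumable` — `F108Consumable` ⇒ (B″): for `f` prime, convenient, weakly non-degenerate along every positive weight, `x̄ᵢ ≠ 0`, regular off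
  the vertex (`k = k̄`, char `p`): `Bl_{(x^A)} X` is FULL at every point, `A` `𝔪`-primary (✓ p656605 §2).
* §3 ★ `fHalfRow_of_F108Consumable` — THE ONE-NAME CONDITIONAL CLASS THEOREM (F-half): under the same hypotheses, for EVERY blowing up `g : S′ → Spec 𝒪_{X,v}` along the point
  floor there is `𝓚 ≠ ⊥` on `S′` supported over the closed point all of whose blowings up are FULL everywhere — CURED (✓ p656605 §3).
* §4 ★ `pointFloorRow_of_F108Consumable` — THE TWO-SIDED CENSUS LETTER ⟨LEGAL, NOT FULL, CURED⟩ from `F108Consumable` + the class hypotheses + the ELEMENTARY per-bed data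
  (point-blow-up chart identities `θᵢ f = Xᵢ^{μᵢ}·gᵢ`, `f, gᵢ ∉ (Xᵢ)`, `v` singular, and ONE Fedder certificate `g_{i₀}(0) = 0`, `g_{i₀}^{p−1} ∈ 𝔪^{[p]}` — decidable by `ring` /
  `add_pow` per bed; NOT FULL lives at the floor, it is not a consequence of the vertex being non-F-pure) (✓ `PointFloorLegalOfIsolated`, ✓ `PointFloorNotFullOfFedder`, §3).
* §5 `pointFloorRow_of_F108Consumable_of_ringEquiv` — the same row for `V(f)` when the hypotheses hold for `f′ = φ f`, `φ` a ring automorphism of `k[X]` with `φ(Xᵢ)`,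
  `φ⁻¹(Xᵢ)` constant-term-free (✓ p678625 `PolyAutRowTransport.pointFloorRow_of_algEquiv`; instances `exists_translate`, e.g. `σ₅` ✓ p680195).
-/

-- single-problem summit: the doubled namespace component is forced
set_option linter.dupNamespace false

noncomputable section

namespace Summit.ResolutionOfSingularities.ResolutionOfSingularities.Theorems.FInjectiveMacaulayfication.F108ClassRow

open CategoryTheory CategoryTheory.Limits AlgebraicGeometry TopologicalSpace IsLocalRing MvPolynomial
open Literature.AlgebraicGeometry.Resolution Literature.AlgebraicGeometry.Resolution.BoubakriGreuelMarkwig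
open Summit.ResolutionOfSingularities.ResolutionOfSingularities.Theorems.FInjectiveMacaulayfication
open SliceableCentre

/-! ## §1 The named hypothesis -/

/-- **`F108Consumable k n`** — OURS INTERFACE PREDICATE (a hypothesis, NOT a Literature fact, NOT proved in the kernel): «for every CONVENIENT `f ∈ k[X₀..X_{n−1}]` (each
variable occurs in `f` as a pure power) there are exponent sets `A`, `K` with `(x^A) = (X₀,…,X_{n−1})·(x^K)` in `k[X]`, both containing pure powers of every variable, every
`e ∈ A` non-zero, and `t` charts — unimodular `V c ∈ ℕ^{n×n}`, vertices `m c ∈ A`, neighbours `a c i ∈ A` with `V c·(a c i) = V c·(m c) + eᵢ`, `V c·(m c) ≤ V c·e` for all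
`e ∈ A`, the Rees cover `∀ e ∈ A ∃ c K ≥ 1, (x^e)^K ∈ x^{m c}·(x^A)^{K−1}` — on each of which the total transform `θ_{V c} f` is a monomial times a polynomial with non-zero
constant term» = the binder block of ✓ p656605 §3 `fHalfRow_of_weaklyNondegenerate` (toric resolution of the Newton fan `Σ_f ∧ Σ(𝔪)` WITH its K/A tables). Believed true
(unimodular projective refinement not subdividing the orthant boundary + strictly convex support function + barycentric Rees certificates); see the module docstring for
why it is carried as a hypothesis. [OURS · definition of an interface predicate; cite: CoxLittleSchenck2011, Thm. 11.1.9 and §11.4; IshiiSingularities2018, Thm. 4.4.23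
(the print facts it packages — not a restatement of either)] -/
@[conjecture] def F108Consumable (k : Type) [Field k] (n : ℕ) : Prop :=
  ∀ f : MvPolynomial (Fin n) k, (∀ j : Fin n, ∃ N : ℕ, 0 < N ∧ MvPolynomial.coeff (Finsupp.single j N) f ≠ 0) →
    ∃ (A KA : Finset (Fin n →₀ ℕ)) (t : ℕ) (m : Fin t → (Fin n →₀ ℕ)) (V : Fin t → Matrix (Fin n) (Fin n) ℕ) (a : Fin t → Fin n → (Fin n →₀ ℕ))
      (g : Fin t → MvPolynomial (Fin n) k) (d : Fin t → (Fin n →₀ ℕ)),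
      Ideal.span ((fun e : Fin n →₀ ℕ => (monomial e (1 : k) : MvPolynomial (Fin n) k)) '' (A : Set (Fin n →₀ ℕ))) =
        Ideal.span (Set.range fun j : Fin n => (X j : MvPolynomial (Fin n) k)) *
          Ideal.span ((fun e : Fin n →₀ ℕ => (monomial e (1 : k) : MvPolynomial (Fin n) k)) '' (KA : Set (Fin n →₀ ℕ))) ∧
      (∀ j : Fin n, ∃ N : ℕ, Finsupp.single j N ∈ KA) ∧
      (∀ j ∈ (Finset.univ : Finset (Fin n)), ∃ N : ℕ, Finsupp.single j N ∈ A) ∧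
      (∀ e ∈ A, ∃ j ∈ (Finset.univ : Finset (Fin n)), 0 < e j) ∧
      (∀ e ∈ A, ∃ (c : Fin t) (K : ℕ), 1 ≤ K ∧ ∃ y ∈ (Ideal.span ((fun b : Fin n →₀ ℕ => (monomial b (1 : k) : MvPolynomial (Fin n) k)) '' (A : Set (Fin n →₀ ℕ)))) ^ (K - 1),
        (monomial e (1 : k) : MvPolynomial (Fin n) k) ^ K = monomial (m c) 1 * y) ∧
      (∀ c, IsUnit ((V c).map (Nat.cast : ℕ → ℤ)).det) ∧
      (∀ c i, a c i ∈ A) ∧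
      (∀ (c : Fin t) (i : Fin n), (Finsupp.equivFunOnFinite.symm ((V c).mulVec ⇑(a c i)) : Fin n →₀ ℕ) =
        Finsupp.equivFunOnFinite.symm ((V c).mulVec ⇑(m c)) + Finsupp.single i 1) ∧
      (∀ (c : Fin t), ∀ e ∈ A, (Finsupp.equivFunOnFinite.symm ((V c).mulVec ⇑(m c)) : Fin n →₀ ℕ) ≤ Finsupp.equivFunOnFinite.symm ((V c).mulVec ⇑e)) ∧
      (∀ c, aeval (fun j : Fin n => ∏ i : Fin n, (X i : MvPolynomial (Fin n) k) ^ V c i j) f = monomial (d c) 1 * g c) ∧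
      (∀ c, constantCoeff (g c) ≠ 0) ∧
      (∀ c, m c ∈ A)

variable (k : Type) [Field k] {n : ℕ}

/-- The product identity `(x^A) = 𝔪·(x^K)` of `k[X]` read in any quotient `k[X]/F` (the form ✓ p656605 §3 takes as `hIA`). [plumbing] -/
theorem span_quotient_eq_mul (F : Ideal (MvPolynomial (Fin n) k)) (A KA : Finset (Fin n →₀ ℕ))
    (hIA : Ideal.span ((fun e : Fin n →₀ ℕ => (monomial e (1 : k) : MvPolynomial (Fin n) k)) '' (A : Set (Fin n →₀ ℕ))) =
      Ideal.span (Set.range fun j : Fin n => (X j : MvPolynomial (Fin n) k)) *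
        Ideal.span ((fun e : Fin n →₀ ℕ => (monomial e (1 : k) : MvPolynomial (Fin n) k)) '' (KA : Set (Fin n →₀ ℕ)))) :
    Ideal.span ((fun e : Fin n →₀ ℕ => Ideal.Quotient.mk F (monomial e (1 : k))) '' (A : Set (Fin n →₀ ℕ))) =
      Ideal.span (Set.range fun j : Fin n => Ideal.Quotient.mk F (X j)) *
        Ideal.span ((fun e : Fin n →₀ ℕ => Ideal.Quotient.mk F (monomial e (1 : k))) '' (KA : Set (Fin n →₀ ℕ))) := by
  have h := congrArg (Ideal.map (Ideal.Quotient.mk F)) hIA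
  rw [Ideal.map_mul, Ideal.map_span, Ideal.map_span, Ideal.map_span, Set.image_image, Set.image_image, ← Set.range_comp] at h
  exact h

/-! ## §2 (B″) from the named hypothesis -/

/-- **`F108Consumable` ⇒ (B″)**: for `f` prime, convenient, weakly non-degenerate along every positive weight, with `x̄ᵢ ≠ 0` and `X = V(f)` regular off the vertex (`k = k̄`,
characteristic `p`), there is an `𝔪`-primary monomial centre `(x^A)` whose affine blowup is FULL at every point. CONDITIONAL on `hF`. [OURS · conditional class theorem;
cite: IshiiSingularities2018, Thm. 4.4.23 and Cor. 4.4.25] -/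
theorem affineBlowup_fullCl_of_F108Consumable (p : ℕ) [Fact p.Prime] [IsAlgClosed k] [CharP k p] (hF : F108Consumable k n)
    (f : MvPolynomial (Fin n) k) (hfp : Prime f) (hconv : ∀ j : Fin n, ∃ N : ℕ, 0 < N ∧ MvPolynomial.coeff (Finsupp.single j N) f ≠ 0)
    (hWND : ∀ w : Fin n → ℝ, (∀ i, 0 < w i) → IsWeaklyNondegenerateAlong w (f : MvPowerSeries (Fin n) k))
    (hXne : ∀ v : Fin n, Ideal.Quotient.mk (Ideal.span {f}) (X v) ≠ 0)
    (hreg : ∀ x : Spec (.of (MvPolynomial (Fin n) k ⧸ Ideal.span {f})),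
      ¬ Ideal.span (Set.range fun j : Fin n => Ideal.Quotient.mk (Ideal.span {f}) (X j)) ≤ x.asIdeal → IsRegularLocalRing (Localization.AtPrime x.asIdeal)) :
    ∃ A : Finset (Fin n →₀ ℕ), (∀ j ∈ (Finset.univ : Finset (Fin n)), ∃ N : ℕ, Finsupp.single j N ∈ A) ∧
      ∀ y : ↥(affineBlowup (Ideal.span ((fun e : Fin n →₀ ℕ => Ideal.Quotient.mk (Ideal.span {f}) (monomial e (1 : k))) '' (A : Set (Fin n →₀ ℕ))))),
        FullCl p ((affineBlowup (Ideal.span ((fun e : Fin n →₀ ℕ => Ideal.Quotient.mk (Ideal.span {f}) (monomial e (1 : k))) '' (A : Set (Fin n →₀ ℕ))))).presheaf.stalk y) := by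
  obtain ⟨A, KA, t, m, V, a, g, d, -, -, hprim, hAJ, hcov, hV, haA, hgen, hge, hθ, hg0, hm⟩ := hF f hconv
  refine ⟨A, hprim, ?_⟩
  have hv : ∀ c : Fin t, Ideal.Quotient.mk (Ideal.span {f}) (monomial (m c) (1 : k)) ∈
      Ideal.span ((fun e : Fin n →₀ ℕ => Ideal.Quotient.mk (Ideal.span {f}) (monomial e (1 : k))) '' (A : Set (Fin n →₀ ℕ))) :=
    fun c => Ideal.subset_span ⟨m c, hm c, rfl⟩
  exact FHalfRowOfNewtonNondegenerate.affineBlowup_fullCl_of_weaklyNondegenerate p k f hfp hWND hXne hreg A hprim hAJ t m hcov V hV a haA hgen hge g d hθ hg0 hv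

/-! ## §3 ★ The one-name conditional class theorem: the F-half (CURED) -/

/-- ★ **THE F-HALF AT CLASS LEVEL, CONDITIONAL ON `F108Consumable k n`**: for `f ∈ k[X₀..X_{n−1}]` (`n ≥ 1`, `k = k̄`, characteristic `p`) prime, CONVENIENT, WEAKLY
NON-DEGENERATE along every positive weight, with `x̄ᵢ ≠ 0` and `X = V(f)` regular off the vertex `v`: for EVERY blowing up `g : S′ → Spec 𝒪_{X,v}` along the point floor
`𝔪̃|_{Spec 𝒪_{X,v}}` there is an ideal sheaf `𝓚 ≠ ⊥` on `S′`, supported over the closed point, ALL of whose blowings up are FULL (`FullCl p`) at every stalk — the point floor is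
CURED. One term on ✓ p656605 §3 after unpacking `hF`. [OURS · conditional class theorem; cite: IshiiSingularities2018, Thm. 4.4.23 and Cor. 4.4.25] [cite: StacksProject, Tag 080A] -/
theorem fHalfRow_of_F108Consumable (p : ℕ) [Fact p.Prime] [IsAlgClosed k] [CharP k p] (hF : F108Consumable k n) (hn : 0 < n)
    (f : MvPolynomial (Fin n) k) (hfp : Prime f) (hconv : ∀ j : Fin n, ∃ N : ℕ, 0 < N ∧ MvPolynomial.coeff (Finsupp.single j N) f ≠ 0)
    (hWND : ∀ w : Fin n → ℝ, (∀ i, 0 < w i) → IsWeaklyNondegenerateAlong w (f : MvPowerSeries (Fin n) k))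
    (hXne : ∀ v : Fin n, Ideal.Quotient.mk (Ideal.span {f}) (X v) ≠ 0)
    (hreg : ∀ x : Spec (.of (MvPolynomial (Fin n) k ⧸ Ideal.span {f})),
      ¬ Ideal.span (Set.range fun j : Fin n => Ideal.Quotient.mk (Ideal.span {f}) (X j)) ≤ x.asIdeal → IsRegularLocalRing (Localization.AtPrime x.asIdeal))
    (v : Spec (.of (MvPolynomial (Fin n) k ⧸ Ideal.span {f})))
    (hvm : v.asIdeal = Ideal.span (Set.range fun j : Fin n => Ideal.Quotient.mk (Ideal.span {f}) (X j))) :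
    ∀ (S' : Scheme.{0}) (gS : S' ⟶ Spec ((Spec (.of (MvPolynomial (Fin n) k ⧸ Ideal.span {f}))).presheaf.stalk v)),
      IsBlowup gS ((affineBlowup.idealSheaf (Ideal.span (Set.range fun j : Fin n => Ideal.Quotient.mk (Ideal.span {f}) (X j)))).comap
        ((Spec (.of (MvPolynomial (Fin n) k ⧸ Ideal.span {f}))).fromSpecStalk v)) →
      ∃ 𝓚 : S'.IdealSheafData, 𝓚 ≠ ⊥ ∧
        (∀ s ∈ (𝓚.support : Set S'), gS.base s = closedPoint ((Spec (.of (MvPolynomial (Fin n) k ⧸ Ideal.span {f}))).presheaf.stalk v)) ∧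
        ∀ (S'' : Scheme.{0}) (π : S'' ⟶ S'), IsBlowup π 𝓚 → ∀ s : S'', FullCl p (S''.presheaf.stalk s) := by
  obtain ⟨A, KA, t, m, V, a, g, d, hIA, hKprim, hprim, hAJ, hcov, hV, haA, hgen, hge, hθ, hg0, hm⟩ := hF f hconv
  have hv : ∀ c : Fin t, Ideal.Quotient.mk (Ideal.span {f}) (monomial (m c) (1 : k)) ∈
      Ideal.span ((fun e : Fin n →₀ ℕ => Ideal.Quotient.mk (Ideal.span {f}) (monomial e (1 : k))) '' (A : Set (Fin n →₀ ℕ))) :=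
    fun c => Ideal.subset_span ⟨m c, hm c, rfl⟩
  exact FHalfRowOfNewtonNondegenerate.fHalfRow_of_weaklyNondegenerate p k hn f hfp hWND hXne hreg A KA (span_quotient_eq_mul k _ A KA hIA) hKprim hprim hAJ
    t m hcov V hV a haA hgen hge g d hθ hg0 hv v hvm

/-! ## §4 ★ The two-sided census letter -/

/-- ★ **THE TWO-SIDED CENSUS ROW AT CLASS LEVEL, CONDITIONAL ON `F108Consumable k n`: LEGAL ∧ NOT FULL ∧ CURED.** Hypotheses: the class hypotheses of §3 (prime, convenient,
weakly non-degenerate, `x̄ᵢ ≠ 0`, regular off the vertex `v`, `v` singular) and the ELEMENTARY per-bed data of the point blow-up — the chart identities `θᵢ f = Xᵢ^{μᵢ}·gᵢ` with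
`f, gᵢ ∉ (Xᵢ)`, `f(0) = 0`, and ONE Fedder certificate at the origin of chart `i₀`: `g_{i₀}(0) = 0`, `g_{i₀}^{p−1} ∈ (X₀^p,…,X_{n−1}^p)`. Conclusion, for every blowing up
`g : S′ → Spec 𝒪_{X,v}` along the point floor: (LEGAL) centre `≠ ⊥`, supported in the non-regular locus, `S′` regular off the closed fibre and CM everywhere; (NOT FULL) some stalk
of `S′` over the closed point is not `FullCl p`; (CURED) §3. [OURS · conditional class theorem; cite: Fedder1983, Thm. 1.12] [cite: IshiiSingularities2018, Thm. 4.4.23] -/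
theorem pointFloorRow_of_F108Consumable (p : ℕ) [Fact p.Prime] [IsAlgClosed k] [CharP k p] (hF : F108Consumable k n) (hn : 0 < n)
    (f : MvPolynomial (Fin n) k) (hfp : Prime f) (hconv : ∀ j : Fin n, ∃ N : ℕ, 0 < N ∧ MvPolynomial.coeff (Finsupp.single j N) f ≠ 0)
    (hWND : ∀ w : Fin n → ℝ, (∀ i, 0 < w i) → IsWeaklyNondegenerateAlong w (f : MvPowerSeries (Fin n) k))
    (hXne : ∀ v : Fin n, Ideal.Quotient.mk (Ideal.span {f}) (X v) ≠ 0)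
    (hreg : ∀ x : Spec (.of (MvPolynomial (Fin n) k ⧸ Ideal.span {f})),
      ¬ Ideal.span (Set.range fun j : Fin n => Ideal.Quotient.mk (Ideal.span {f}) (X j)) ≤ x.asIdeal → IsRegularLocalRing (Localization.AtPrime x.asIdeal))
    (μ : Fin n → ℕ) (gθ : Fin n → MvPolynomial (Fin n) k)
    (hθ : ∀ i : Fin n, aeval (fun j : Fin n => if j = i then (X i : MvPolynomial (Fin n) k) else X j * X i) f = X i ^ μ i * gθ i)
    (hfX : ∀ i : Fin n, f ∉ Ideal.span {(X i : MvPolynomial (Fin n) k)}) (hgX : ∀ i : Fin n, gθ i ∉ Ideal.span {(X i : MvPolynomial (Fin n) k)})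
    (hf0 : constantCoeff f = 0) (i₀ : Fin n) (hc : constantCoeff (gθ i₀) = 0)
    (hfed : gθ i₀ ^ (p - 1) ∈ Ideal.span (Set.range fun j : Fin n => (X j : MvPolynomial (Fin n) k) ^ p))
    (v : Spec (.of (MvPolynomial (Fin n) k ⧸ Ideal.span {f})))
    (hvm : v.asIdeal = Ideal.span (Set.range fun j : Fin n => Ideal.Quotient.mk (Ideal.span {f}) (X j)))
    (hsing : v ∉ Scheme.regularLocus (Spec (.of (MvPolynomial (Fin n) k ⧸ Ideal.span {f}))))
    (S' : Scheme.{0}) (gS : S' ⟶ Spec ((Spec (.of (MvPolynomial (Fin n) k ⧸ Ideal.span {f}))).presheaf.stalk v))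
    (hgS : IsBlowup gS ((affineBlowup.idealSheaf (Ideal.span (Set.range fun j : Fin n => Ideal.Quotient.mk (Ideal.span {f}) (X j)))).comap
      ((Spec (.of (MvPolynomial (Fin n) k ⧸ Ideal.span {f}))).fromSpecStalk v))) :
    (((affineBlowup.idealSheaf (Ideal.span (Set.range fun j : Fin n => Ideal.Quotient.mk (Ideal.span {f}) (X j)))).comap
        ((Spec (.of (MvPolynomial (Fin n) k ⧸ Ideal.span {f}))).fromSpecStalk v)) ≠ ⊥ ∧
      ((((affineBlowup.idealSheaf (Ideal.span (Set.range fun j : Fin n => Ideal.Quotient.mk (Ideal.span {f}) (X j)))).comap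
        ((Spec (.of (MvPolynomial (Fin n) k ⧸ Ideal.span {f}))).fromSpecStalk v)).support :
          Set (Spec ((Spec (.of (MvPolynomial (Fin n) k ⧸ Ideal.span {f}))).presheaf.stalk v))) ⊆
        (Scheme.regularLocus (Spec ((Spec (.of (MvPolynomial (Fin n) k ⧸ Ideal.span {f}))).presheaf.stalk v)))ᶜ) ∧
      (∀ s : S', gS.base s ≠ closedPoint _ → s ∈ Scheme.regularLocus S') ∧ (∀ s : S', CMCl (S'.presheaf.stalk s))) ∧
    (∃ s : S', gS.base s = closedPoint _ ∧ ¬ FullCl p (S'.presheaf.stalk s)) ∧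
    (∃ 𝓚 : S'.IdealSheafData, 𝓚 ≠ ⊥ ∧ (∀ s ∈ (𝓚.support : Set S'), gS.base s = closedPoint _) ∧
      ∀ (S'' : Scheme.{0}) (π : S'' ⟶ S'), IsBlowup π 𝓚 → ∀ s : S'', FullCl p (S''.presheaf.stalk s)) := by
  have hreg' : ∀ y : Spec (.of (MvPolynomial (Fin n) k ⧸ Ideal.span {f})), y ⤳ v → y ≠ v →
      y ∈ Scheme.regularLocus (Spec (.of (MvPolynomial (Fin n) k ⧸ Ideal.span {f}))) := by
    intro y hy hne
    refine FermatCubicConeGerm.mem_regularLocus_Spec_of_isRegularLocalRing y (hreg y fun hle => hne ?_)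
    have hyv : y.asIdeal ≤ v.asIdeal := (PrimeSpectrum.le_iff_specializes y v).mpr hy
    exact PrimeSpectrum.ext (le_antisymm hyv (hvm ▸ hle))
  exact ⟨PointFloorLegalOfIsolated.pointFloor_input_legal k f hfp hn μ gθ hθ hfX hgX v hvm hsing hreg' S' gS hgS,
    PointFloorNotFullOfFedder.pointFloor_not_full p k f hfp μ gθ hθ hfX hgX hf0 i₀ hc hfed v hvm S' gS hgS,
    fHalfRow_of_F108Consumable k p hF hn f hfp hconv hWND hXne hreg v hvm S' gS hgS⟩

/-! ## §5 Along coordinate changes fixing the origin -/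

/-- **The two-sided row for `V(f)` from the class hypotheses for `f′ = φ f`** (`φ` a ring automorphism of `k[X]` with `φ(Xᵢ)`, `φ⁻¹(Xᵢ)` constant-term-free, e.g. the
`exists_translate` instances `Xⱼ ↦ Xⱼ + c·Xᵢ^b`): ✓ p678625 `pointFloorRow_of_algEquiv` on §4 for `f′`. CONDITIONAL on `hF`. So a bed that is convenient and weakly
non-degenerate in SOME coordinates of this kind gets its row. [OURS · conditional class theorem; cite: GortzWedhorn2020, (13.19)] -/
theorem pointFloorRow_of_F108Consumable_of_ringEquiv (p : ℕ) [Fact p.Prime] [IsAlgClosed k] [CharP k p] (hF : F108Consumable k n) (hn : 0 < n)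
    (φ : MvPolynomial (Fin n) k ≃+* MvPolynomial (Fin n) k)
    (h₁ : ∀ i : Fin n, constantCoeff (φ (X i)) = 0) (h₂ : ∀ i : Fin n, constantCoeff (φ.symm (X i)) = 0)
    (f f' : MvPolynomial (Fin n) k) (hff' : φ f = f') (hfp : Prime f') (hconv : ∀ j : Fin n, ∃ N : ℕ, 0 < N ∧ MvPolynomial.coeff (Finsupp.single j N) f' ≠ 0)
    (hWND : ∀ w : Fin n → ℝ, (∀ i, 0 < w i) → IsWeaklyNondegenerateAlong w (f' : MvPowerSeries (Fin n) k))
    (hXne : ∀ v : Fin n, Ideal.Quotient.mk (Ideal.span {f'}) (X v) ≠ 0)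
    (hreg : ∀ x : Spec (.of (MvPolynomial (Fin n) k ⧸ Ideal.span {f'})),
      ¬ Ideal.span (Set.range fun j : Fin n => Ideal.Quotient.mk (Ideal.span {f'}) (X j)) ≤ x.asIdeal → IsRegularLocalRing (Localization.AtPrime x.asIdeal))
    (μ : Fin n → ℕ) (gθ : Fin n → MvPolynomial (Fin n) k)
    (hθ : ∀ i : Fin n, aeval (fun j : Fin n => if j = i then (X i : MvPolynomial (Fin n) k) else X j * X i) f' = X i ^ μ i * gθ i)
    (hfX : ∀ i : Fin n, f' ∉ Ideal.span {(X i : MvPolynomial (Fin n) k)}) (hgX : ∀ i : Fin n, gθ i ∉ Ideal.span {(X i : MvPolynomial (Fin n) k)})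
    (hf0 : constantCoeff f' = 0) (i₀ : Fin n) (hc : constantCoeff (gθ i₀) = 0)
    (hfed : gθ i₀ ^ (p - 1) ∈ Ideal.span (Set.range fun j : Fin n => (X j : MvPolynomial (Fin n) k) ^ p))
    (hsing : ∀ v : Spec (.of (MvPolynomial (Fin n) k ⧸ Ideal.span {f'})),
      v.asIdeal = Ideal.span (Set.range fun j : Fin n => Ideal.Quotient.mk (Ideal.span {f'}) (X j)) →
      v ∉ Scheme.regularLocus (Spec (.of (MvPolynomial (Fin n) k ⧸ Ideal.span {f'})))) :
    ∀ (v' : Spec (.of (MvPolynomial (Fin n) k ⧸ Ideal.span {f}))),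
      v'.asIdeal = Ideal.span (Set.range fun j : Fin n => Ideal.Quotient.mk (Ideal.span {f}) (X j)) →
      ∀ (S' : Scheme.{0}) (g₁ : S' ⟶ Spec ((Spec (.of (MvPolynomial (Fin n) k ⧸ Ideal.span {f}))).presheaf.stalk v')),
        IsBlowup g₁ ((affineBlowup.idealSheaf (Ideal.span (Set.range fun j : Fin n => Ideal.Quotient.mk (Ideal.span {f}) (X j)))).comap
          ((Spec (.of (MvPolynomial (Fin n) k ⧸ Ideal.span {f}))).fromSpecStalk v')) →
        (((affineBlowup.idealSheaf (Ideal.span (Set.range fun j : Fin n => Ideal.Quotient.mk (Ideal.span {f}) (X j)))).comap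
            ((Spec (.of (MvPolynomial (Fin n) k ⧸ Ideal.span {f}))).fromSpecStalk v')) ≠ ⊥ ∧
          ((((affineBlowup.idealSheaf (Ideal.span (Set.range fun j : Fin n => Ideal.Quotient.mk (Ideal.span {f}) (X j)))).comap
            ((Spec (.of (MvPolynomial (Fin n) k ⧸ Ideal.span {f}))).fromSpecStalk v')).support :
              Set (Spec ((Spec (.of (MvPolynomial (Fin n) k ⧸ Ideal.span {f}))).presheaf.stalk v'))) ⊆
            (Scheme.regularLocus (Spec ((Spec (.of (MvPolynomial (Fin n) k ⧸ Ideal.span {f}))).presheaf.stalk v')))ᶜ) ∧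
          (∀ s : S', g₁.base s ≠ closedPoint _ → s ∈ Scheme.regularLocus S') ∧ (∀ s : S', CMCl (S'.presheaf.stalk s))) ∧
        (∃ s : S', g₁.base s = closedPoint _ ∧ ¬ FullCl p (S'.presheaf.stalk s)) ∧
        (∃ 𝓚 : S'.IdealSheafData, 𝓚 ≠ ⊥ ∧ (∀ s ∈ (𝓚.support : Set S'), g₁.base s = closedPoint _) ∧
          ∀ (S'' : Scheme.{0}) (π : S'' ⟶ S'), IsBlowup π 𝓚 → ∀ s : S'', FullCl p (S''.presheaf.stalk s)) :=
  PolyAutRowTransport.pointFloorRow_of_algEquiv k p φ h₁ h₂ f f' hff' fun v hv S' g₁ hg₁ =>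
    pointFloorRow_of_F108Consumable k p hF hn f' hfp hconv hWND hXne hreg μ gθ hθ hfX hgX hf0 i₀ hc hfed v hv (hsing v hv) S' g₁ hg₁

end Summit.ResolutionOfSingularities.ResolutionOfSingularities.Theorems.FInjectiveMacaulayfication.F108ClassRow

end
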